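import Mathlib.Analysis.MeanInequalities
import Mathlib.Analysis.Convex.Function
import Mathlib.Analysis.SpecialFunctions.Pow.Real
import HarnessLib

/-!
# Hamilton 1986, Lemma 6.3: `f^α g^β` is concave for concave positive `f`, `g`, `α + β = 1`
(topic `Geometry/Riemannian`)

A step of the decomposition of the named fact
`Literature.Geometry.Riemannian.hamilton_positiveCurvatureOperator_classification_four`
(`HamiltonPCOClassification.lean`; Hamilton 1986, Thm. 1.1). The pinching set `Z` of Hamilton's
Thm. 7.1 is cut out by inequalities such as `(b₂ + b₃)^{2+δ} ≤ J a₁ c₁ (a - 2b + c)^δ` and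
`a₃ ≤ a₁ + L a₁^{1-θ}`, and its convexity ("That `Z` is convex follows from Lemma 6.3", p. 170)
rests on:

> **6.3. Lemma** (J. Differential Geom. 24 (1986), p. 170). If `f` and `g` are concave and
> positive and if `α + β = 1`, then `f^α g^β` is concave.

(together with "if `f` is a convex function and `g` is a concave function, the set where `f ≤ g`
is convex", p. 170). Hamilton's proof computes the Hessian of `z = x^α y^β`; we PROVE the lemma
from the weighted AM–GM inequality (Mathlib's `Real.geom_mean_le_arith_mean2_weighted`), via
the two-point Hölder inequality `a x₁^α y₁^β + b x₂^α y₂^β ≤ (a x₁ + b x₂)^α (a y₁ + b y₂)^β`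
(`combo_rpow_mul_rpow_le`), for `0 < α`, `0 < β`, `α + β = 1` and nonnegative (rather than
positive) `f`, `g` on an arbitrary convex set of a real vector space.

## References

* R. S. Hamilton, *Four-manifolds with positive curvature operator*, J. Differential Geom. 24
  (1986) 153–179, §6, Lemma 6.3 (p. 170) and §7, proof of Thm. 7.1 (p. 170). [Hamilton1986]
-/

noncomputable section

open Set

namespace Literature.Geometry.Riemannian

/-- **Two-point Hölder inequality for the weighted geometric mean**: for `x₁, x₂, y₁, y₂ ≥ 0`,
weights `a, b ≥ 0` and exponents `α, β > 0` with `α + β = 1`,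
`a x₁^α y₁^β + b x₂^α y₂^β ≤ (a x₁ + b x₂)^α (a y₁ + b y₂)^β` — i.e. `(x, y) ↦ x^α y^β` is
concave (and positively homogeneous) on the quadrant. (Normalise by `X = a x₁ + b x₂`,
`Y = a y₁ + b y₂` and apply `p^α q^β ≤ α p + β q`.) [folklore] -/
theorem combo_rpow_mul_rpow_le {x₁ x₂ y₁ y₂ a b α β : ℝ} (hx₁ : 0 ≤ x₁) (hx₂ : 0 ≤ x₂)
    (hy₁ : 0 ≤ y₁) (hy₂ : 0 ≤ y₂) (ha : 0 ≤ a) (hb : 0 ≤ b) (hα : 0 < α) (hβ : 0 < β)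
    (hαβ : α + β = 1) :
    a * (x₁ ^ α * y₁ ^ β) + b * (x₂ ^ α * y₂ ^ β) ≤
      (a * x₁ + b * x₂) ^ α * (a * y₁ + b * y₂) ^ β := by
  set X := a * x₁ + b * x₂ with hX
  set Y := a * y₁ + b * y₂ with hY
  have hX0 : 0 ≤ X := by positivity
  have hY0 : 0 ≤ Y := by positivity
  -- degenerate cases `X = 0` or `Y = 0`: both sides vanish
  rcases hX0.eq_or_lt with hX0' | hXpos
  · have h1 : a * x₁ = 0 := by nlinarith [mul_nonneg ha hx₁, mul_nonneg hb hx₂]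
    have h2 : b * x₂ = 0 := by nlinarith [mul_nonneg ha hx₁, mul_nonneg hb hx₂]
    have e1 : a * (x₁ ^ α * y₁ ^ β) = 0 := by
      rcases mul_eq_zero.1 h1 with h | h
      · rw [h, zero_mul]
      · rw [h, Real.zero_rpow hα.ne', zero_mul, mul_zero]
    have e2 : b * (x₂ ^ α * y₂ ^ β) = 0 := by
      rcases mul_eq_zero.1 h2 with h | h
      · rw [h, zero_mul]
      · rw [h, Real.zero_rpow hα.ne', zero_mul, mul_zero]
    rw [e1, e2, add_zero]
    positivity
  rcases hY0.eq_or_lt with hY0' | hYpos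
  · have h1 : a * y₁ = 0 := by nlinarith [mul_nonneg ha hy₁, mul_nonneg hb hy₂]
    have h2 : b * y₂ = 0 := by nlinarith [mul_nonneg ha hy₁, mul_nonneg hb hy₂]
    have e1 : a * (x₁ ^ α * y₁ ^ β) = 0 := by
      rcases mul_eq_zero.1 h1 with h | h
      · rw [h, zero_mul]
      · rw [h, Real.zero_rpow hβ.ne', mul_zero, mul_zero]
    have e2 : b * (x₂ ^ α * y₂ ^ β) = 0 := by
      rcases mul_eq_zero.1 h2 with h | h
      · rw [h, zero_mul]
      · rw [h, Real.zero_rpow hβ.ne', mul_zero, mul_zero]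
    rw [e1, e2, add_zero]
    positivity
  -- main case: normalise and use weighted AM–GM
  have key : ∀ {x y : ℝ}, 0 ≤ x → 0 ≤ y →
      x ^ α * y ^ β ≤ X ^ α * Y ^ β * (α * (x / X) + β * (y / Y)) := by
    intro x y hx hy
    have hagm := Real.geom_mean_le_arith_mean2_weighted hα.le hβ.le (div_nonneg hx hXpos.le)
      (div_nonneg hy hYpos.le) hαβ
    rw [Real.div_rpow hx hXpos.le, Real.div_rpow hy hYpos.le] at hagm
    have hXa : 0 < X ^ α := Real.rpow_pos_of_pos hXpos α
    have hYb : 0 < Y ^ β := Real.rpow_pos_of_pos hYpos β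
    rw [div_mul_div_comm, div_le_iff₀ (mul_pos hXa hYb)] at hagm
    linarith
  have h1 := key hx₁ hy₁
  have h2 := key hx₂ hy₂
  have hsum : a * (α * (x₁ / X) + β * (y₁ / Y)) + b * (α * (x₂ / X) + β * (y₂ / Y)) = 1 := by
    have eX : a * (x₁ / X) + b * (x₂ / X) = 1 := by
      rw [mul_div_assoc', mul_div_assoc', ← add_div, div_eq_one_iff_eq hXpos.ne']
    have eY : a * (y₁ / Y) + b * (y₂ / Y) = 1 := by
      rw [mul_div_assoc', mul_div_assoc', ← add_div, div_eq_one_iff_eq hYpos.ne']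
    linear_combination α * eX + β * eY + hαβ
  have hP : 0 ≤ X ^ α * Y ^ β := by positivity
  calc a * (x₁ ^ α * y₁ ^ β) + b * (x₂ ^ α * y₂ ^ β)
      ≤ a * (X ^ α * Y ^ β * (α * (x₁ / X) + β * (y₁ / Y))) +
          b * (X ^ α * Y ^ β * (α * (x₂ / X) + β * (y₂ / Y))) :=
        add_le_add (mul_le_mul_of_nonneg_left h1 ha) (mul_le_mul_of_nonneg_left h2 hb)
    _ = X ^ α * Y ^ β *
          (a * (α * (x₁ / X) + β * (y₁ / Y)) + b * (α * (x₂ / X) + β * (y₂ / Y))) := by ring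
    _ = X ^ α * Y ^ β := by rw [hsum, mul_one]

end Literature.Geometry.Riemannian

/-- **Hamilton 1986, Lemma 6.3.** If `f` and `g` are concave and nonnegative on a convex set `s`
and `α, β > 0` with `α + β = 1`, then `f^α g^β` is concave on `s` ("If `f` and `g` are concave
and positive and if `α + β = 1`, then `f^α g^β` is concave", J. Differential Geom. 24 (1986),
p. 170; used there for the convexity of the pinching set of Thm. 7.1). Proof: concavity of
`f`, `g`, monotonicity of `t ↦ t^α`, `t ↦ t^β`, and the two-point Hölder inequality
`combo_rpow_mul_rpow_le`. A deliberate dot-notation extension of Mathlib's `ConcaveOn`.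
[cite: Hamilton1986, §6, Lemma 6.3 (p. 170)] -/
theorem ConcaveOn.rpow_mul_rpow {E : Type*} [AddCommGroup E] [Module ℝ E] {s : Set E}
    {f g : E → ℝ} (hf : ConcaveOn ℝ s f) (hg : ConcaveOn ℝ s g) (hf0 : ∀ x ∈ s, 0 ≤ f x)
    (hg0 : ∀ x ∈ s, 0 ≤ g x) {α β : ℝ} (hα : 0 < α) (hβ : 0 < β) (hαβ : α + β = 1) :
    ConcaveOn ℝ s (fun x ↦ f x ^ α * g x ^ β) := by
  refine ⟨hf.1, fun x hx y hy a b ha hb hab ↦ ?_⟩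
  have hfc := hf.2 hx hy ha hb hab
  have hgc := hg.2 hx hy ha hb hab
  have hxy : a • x + b • y ∈ s := hf.1 hx hy ha hb hab
  simp only [smul_eq_mul] at hfc hgc ⊢
  have hF0 : 0 ≤ a * f x + b * f y := by
    have := hf0 x hx; have := hf0 y hy; positivity
  have hG0 : 0 ≤ a * g x + b * g y := by
    have := hg0 x hx; have := hg0 y hy; positivity
  calc a * (f x ^ α * g x ^ β) + b * (f y ^ α * g y ^ β)
      ≤ (a * f x + b * f y) ^ α * (a * g x + b * g y) ^ β :=
        Literature.Geometry.Riemannian.combo_rpow_mul_rpow_le (hf0 x hx) (hf0 y hy) (hg0 x hx)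
          (hg0 y hy) ha hb hα hβ hαβ
    _ ≤ f (a • x + b • y) ^ α * g (a • x + b • y) ^ β := by
        refine mul_le_mul (Real.rpow_le_rpow hF0 hfc hα.le) (Real.rpow_le_rpow hG0 hgc hβ.le)
          (Real.rpow_nonneg hG0 β) (Real.rpow_nonneg (hf0 _ hxy) α)

/-- **The sublevel comparison of a convex and a concave function is convex** (Hamilton 1986,
p. 170: "In general if `f` is a convex function and `g` is a concave function, the set where
`f ≤ g` is convex"). A deliberate dot-notation extension of Mathlib's `ConvexOn`.
[cite: Hamilton1986, §6, p. 170] -/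
theorem ConvexOn.convex_setOf_le_concaveOn {E : Type*} [AddCommGroup E] [Module ℝ E]
    {s : Set E} {f g : E → ℝ} (hf : ConvexOn ℝ s f) (hg : ConcaveOn ℝ s g) :
    Convex ℝ {x ∈ s | f x ≤ g x} := by
  intro x hx y hy a b ha hb hab
  refine ⟨hf.1 hx.1 hy.1 ha hb hab, ?_⟩
  have h1 := hf.2 hx.1 hy.1 ha hb hab
  have h2 := hg.2 hx.1 hy.1 ha hb hab
  simp only [smul_eq_mul] at h1 h2
  have h3 : a * f x + b * f y ≤ a * g x + b * g y :=
    add_le_add (mul_le_mul_of_nonneg_left hx.2 ha) (mul_le_mul_of_nonneg_left hy.2 hb)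
  exact h1.trans (h3.trans h2)

end
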